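import Mathlib
import HarnessLib
import Summits.HubbardSuperconductivity.HubbardSuperconductivity.Theorems.KLProgrammeKLRegimeEngineV8PairTransferRelBar

/-!
# Route `KLProgramme` — ENGINE child gen 8 (stmt-HubbardSuperconductivity-20437 `KLRegimeEngineV17F2`), skeleton v2 class #5 «(S)-transfer» rev 3 (RELATIVE family):
# the relative bar WITH THE FLOOR SLOT GAINED — `transferBarRelAtWF`, `transferBarRelAtF` (the `TB` of record for `PairTransferRelFamily`; successor of
# `transferBarRelAt`, `…EngineV8PairTransferRelBar` p586507, which stays as the un-gained majorant)

Cell gate-hubbard-kl, seat hubbard-kl-k3c1-p1 (g10).  WHY (recount (R54p), KL STATUS k3c1-p1 23:5xZ; CLASS5-DEFECT-BUDGET-2 §3 (W_fl)).  In `transferBarRelAtW` the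
born-overlap slot is `(KlamU)²·ov` with a CONSTANT profile.  Its inheritance is harmless (the overlap of a pair still admissible at the next scale with the old band
is `0`: `klShellOverlap_eq_zero_of_isSoftSymbol_succ`, p586307), but the CONSUMER cannot host it: at the `ρ = 0` labels rev 2's `transferBarAt` offers only
`(KlamU)²·G.phGain n 0 = (KlamU)²·2^57·Λₙ` (klEngGeo8, `n ≥ 13`), while `ov` of a full member is `O(10⁴)`.  The TRUE zero-transfer source — one slice line against
the soft difference line at equal momentum and frequency — is, for the RADIAL symbols of record (functions of `ω² + e_K²`: `0`, `1 − w_{Λₙ}`, the complementary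
`s_{n,m}` and their sums), `≍ (KlamU)²·ov·(c₁Λₙ + c₂·4^{−(n_β−n)})`: the angular integral `∮cos 2θ` of `Re ĝ² = (e² − ω²)/(ω² + e²)²` vanishes on every circle, leaving
the density-of-states variation across the band (`∝ Λₙ`) and the Matsubara discreteness (`∝ 1/(βΛₙ)` = the `thermalBar` shape, hosted by the thermal slot since
`ov ≤ ms`).  Hence the floor slot of record is `(KlamU)²·(4ⁿ)⁻¹·ov` — this file: `transferBarRelAtWF … n ms ov := transferBarRelAtW … n ms ((4ⁿ)⁻¹·ov)` and its
symbol-level instance `transferBarRelAtF`; every lemma of p586507 transfers (`_nonneg`, `_mono`, the inheritance room `transferBarRelAtWF_succ_room`, `_comm`,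
`_self`).  The per-slice floor input of the (c) lane is accordingly the SIGNED (radial) two-shell below-resolution row, not a sign-blind norm; for non-radial symbols
the family's floor claim would be false at deep scales, so the step Prop should quantify the relative family over RADIAL admissible pairs (text owner's call;
all members any consumer reads are radial).  Definitions + real arithmetic; nothing about the model is asserted.  0 kit.
-/

noncomputable section

namespace Summit.HubbardSuperconductivity.HubbardSuperconductivity.Theorems.KLRegimeSplit

set_option linter.dupNamespace false -- summit = problem name (single-conjunct summit), D-0017

open Real Finset Literature.MathematicalPhysics.QuantumLattice Literature.Probability.LatticeModels
open Summit.HubbardSuperconductivity.HubbardSuperconductivity.Theorems.KLProgrammeLegKernels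
open Summit.HubbardSuperconductivity.HubbardSuperconductivity.Theorems.DispersionFlow

/-! ## §1 The floor-gained relative bar on numeric weights -/

section BarWF

variable (L : ℕ)

/-- **The relative bar with the floor slot gained**: `transferBarRelAtWF … n ms ov := transferBarRelAtW … n ms ((4ⁿ)⁻¹·ov)`, i.e.
`r·{(KlamU)²·[(klRelGain n ρ_d + klRelGain n ρ_x + 2^{−n} + 1/L)·ms + (4ⁿ)⁻¹·ov] + [(Klam|U|)³2^{−n} + thermalBar n]·ms}`. -/
def transferBarRelAtWF (G : GeoConsts) (P : SplitConsts) (r β U : ℝ) (n : ℕ) (ms ov : ℝ) (Qm k k' : TorusSite 2 L) : ℝ :=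
  transferBarRelAtW L G P r β U n ms (((4 : ℝ) ^ n)⁻¹ * ov) Qm k k'

variable {L}

/-- Unfolding. -/
theorem transferBarRelAtWF_eq (G : GeoConsts) (P : SplitConsts) (r β U : ℝ) (n : ℕ) (ms ov : ℝ) (Qm k k' : TorusSite 2 L) :
    transferBarRelAtWF L G P r β U n ms ov Qm k k' =
      r * ((P.Klam * U) ^ 2 * ((klRelGain n (klTorusNorm L (k - k')) + klRelGain n (klTorusNorm L (k + k' - Qm)) + ((2 : ℝ) ^ n)⁻¹ + ((L : ℝ))⁻¹) * ms +
          ((4 : ℝ) ^ n)⁻¹ * ov) + ((P.Klam * |U|) ^ 3 * ((2 : ℝ) ^ n)⁻¹ + thermalBar G P U β n) * ms) := rfl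

/-- Nonnegativity (`0 ≤ r`, `0 ≤ P.Klam`, `0 ≤ G.CF`, `0 ≤ ms`, `0 ≤ ov`). -/
theorem transferBarRelAtWF_nonneg {G : GeoConsts} (hCF : 0 ≤ G.CF) {P : SplitConsts} (hK : 0 ≤ P.Klam) {r : ℝ} (hr : 0 ≤ r) (β U : ℝ) (n : ℕ) {ms ov : ℝ}
    (hms : 0 ≤ ms) (hov : 0 ≤ ov) (Qm k k' : TorusSite 2 L) : 0 ≤ transferBarRelAtWF L G P r β U n ms ov Qm k k' :=
  transferBarRelAtW_nonneg hCF hK hr β U n hms (by positivity) Qm k k'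

/-- Monotonicity in the two weights. -/
theorem transferBarRelAtWF_mono {G : GeoConsts} (hCF : 0 ≤ G.CF) {P : SplitConsts} (hK : 0 ≤ P.Klam) {r : ℝ} (hr : 0 ≤ r) (β U : ℝ) (n : ℕ)
    {ms ms' ov ov' : ℝ} (hms : ms ≤ ms') (hov : ov ≤ ov') (Qm k k' : TorusSite 2 L) :
    transferBarRelAtWF L G P r β U n ms ov Qm k k' ≤ transferBarRelAtWF L G P r β U n ms' ov' Qm k k' :=
  transferBarRelAtW_mono hCF hK hr β U n hms (mul_le_mul_of_nonneg_left hov (by positivity)) Qm k k'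

/-- The floor-gained bar is below the un-gained one (`ov ≥ 0`; `(4ⁿ)⁻¹ ≤ 1`). -/
theorem transferBarRelAtWF_le_W {G : GeoConsts} (hCF : 0 ≤ G.CF) {P : SplitConsts} (hK : 0 ≤ P.Klam) {r : ℝ} (hr : 0 ≤ r) (β U : ℝ) (n : ℕ) (ms : ℝ)
    {ov : ℝ} (hov : 0 ≤ ov) (Qm k k' : TorusSite 2 L) :
    transferBarRelAtWF L G P r β U n ms ov Qm k k' ≤ transferBarRelAtW L G P r β U n ms ov Qm k k' := by
  refine transferBarRelAtW_mono hCF hK hr β U n le_rfl ?_ Qm k k'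
  have h4 : ((4 : ℝ) ^ n)⁻¹ ≤ 1 := inv_le_one_of_one_le₀ (one_le_pow₀ (by norm_num))
  nlinarith

/-- **INHERITANCE ROOM, floor-gained form**: `barF(n, ms, 0) + r·{(KlamU)²[(u(ρ_d) + u(ρ_x) + 2^{−n} + 3/L)·ms + (4ⁿ⁺¹)⁻¹·ov′] + [(Klam|U|)³2^{−n} + 3·thermalBar(n+1)]·ms}
≤ barF(n+1, 4·ms, ov′)` (`transferBarRelAtW_succ_room` with the overlap re-weighted). -/
theorem transferBarRelAtWF_succ_room {G : GeoConsts} (hCF : 0 ≤ G.CF) (P : SplitConsts) {r : ℝ} (hr : 0 ≤ r) (β U : ℝ) (n : ℕ) {ms : ℝ} (hms : 0 ≤ ms)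
    (ov' : ℝ) (Qm k k' : TorusSite 2 L) :
    transferBarRelAtWF L G P r β U n ms 0 Qm k k' +
        r * ((P.Klam * U) ^ 2 *
              ((min (klTorusNorm L (k - k') / klScale klE0 (n + 1)) (klScale klE0 (n + 1) / klTorusNorm L (k - k')) +
                  min (klTorusNorm L (k + k' - Qm) / klScale klE0 (n + 1)) (klScale klE0 (n + 1) / klTorusNorm L (k + k' - Qm)) +
                  ((2 : ℝ) ^ n)⁻¹ + 3 * ((L : ℝ))⁻¹) * ms + ((4 : ℝ) ^ (n + 1))⁻¹ * ov') +
            ((P.Klam * |U|) ^ 3 * ((2 : ℝ) ^ n)⁻¹ + 3 * thermalBar G P U β (n + 1)) * ms) ≤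
      transferBarRelAtWF L G P r β U (n + 1) (4 * ms) ov' Qm k k' := by
  have h := transferBarRelAtW_succ_room (L := L) hCF P hr β U n hms (((4 : ℝ) ^ (n + 1))⁻¹ * ov') Qm k k'
  unfold transferBarRelAtWF
  rw [mul_zero]
  exact h

end BarWF

/-! ## §2 The symbol-level instance of record -/

section BarF

variable (L M : ℕ) [NeZero L] [NeZero M]

/-- **`transferBarRelAtF G P r β U μ n ψ₁ ψ₂ Qm k k′`** — the relative bar of record of the pair `(ψ₁ | ψ₂)` at scale `n`: `transferBarRelAtWF` at the soft mass and the born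
overlap of `ψ₁ − ψ₂` at the flowing frame `Kₙ` (the overlap weighted by `(4ⁿ)⁻¹`). -/
def transferBarRelAtF (G : GeoConsts) (P : SplitConsts) (r β U μ : ℝ) (n : ℕ) (ψ₁ ψ₂ : FreqMomentum L M → ℝ) (Qm k k' : TorusSite 2 L) : ℝ :=
  transferBarRelAtWF L G P r β U n (klSoftMass L M β μ (klFlowFrameU L M β U μ n) n (ψ₁ - ψ₂))
    (klShellOverlap L M β μ (klFlowFrameU L M β U μ n) n (ψ₁ - ψ₂)) Qm k k'

variable {L M}

/-- `transferBarRelAtF = transferBarRelAtW` at the re-weighted overlap (the form the numeric lemmas consume). -/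
theorem transferBarRelAtF_eq_W (G : GeoConsts) (P : SplitConsts) (r β U μ : ℝ) (n : ℕ) (ψ₁ ψ₂ : FreqMomentum L M → ℝ) (Qm k k' : TorusSite 2 L) :
    transferBarRelAtF L M G P r β U μ n ψ₁ ψ₂ Qm k k' =
      transferBarRelAtW L G P r β U n (klSoftMass L M β μ (klFlowFrameU L M β U μ n) n (ψ₁ - ψ₂))
        (((4 : ℝ) ^ n)⁻¹ * klShellOverlap L M β μ (klFlowFrameU L M β U μ n) n (ψ₁ - ψ₂)) Qm k k' := rfl

/-- The bar of record is below the un-gained `transferBarRelAt` (`0 < β`, `0 ≤ r`, `0 ≤ P.Klam`, `0 ≤ G.CF`). -/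
theorem transferBarRelAtF_le {G : GeoConsts} (hCF : 0 ≤ G.CF) {P : SplitConsts} (hK : 0 ≤ P.Klam) {r : ℝ}
    (hr : 0 ≤ r) {β : ℝ} (hβ : 0 < β) (U μ : ℝ) (n : ℕ) (ψ₁ ψ₂ : FreqMomentum L M → ℝ) (Qm k k' : TorusSite 2 L) :
    transferBarRelAtF L M G P r β U μ n ψ₁ ψ₂ Qm k k' ≤ transferBarRelAt L M G P r β U μ n ψ₁ ψ₂ Qm k k' :=
  transferBarRelAtWF_le_W hCF hK hr β U n _ (klShellOverlap_nonneg β μ _ hβ n _) Qm k k'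

/-- Symmetry in the pair. -/
theorem transferBarRelAtF_comm (G : GeoConsts) (P : SplitConsts) (r β U μ : ℝ) (n : ℕ) (ψ₁ ψ₂ : FreqMomentum L M → ℝ) (Qm k k' : TorusSite 2 L) :
    transferBarRelAtF L M G P r β U μ n ψ₁ ψ₂ Qm k k' = transferBarRelAtF L M G P r β U μ n ψ₂ ψ₁ Qm k k' := by
  unfold transferBarRelAtF
  rw [klSoftMass_sub_comm]
  congr 1
  unfold klShellOverlap
  congr 1
  refine sum_congr rfl fun x _ => ?_
  rw [Pi.sub_apply, Pi.sub_apply, abs_sub_comm]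

/-- Nonnegativity (`0 < β`, `0 ≤ r`, `0 ≤ P.Klam`, `0 ≤ G.CF`). -/
theorem transferBarRelAtF_nonneg {G : GeoConsts} (hCF : 0 ≤ G.CF) {P : SplitConsts} (hK : 0 ≤ P.Klam) {r : ℝ} (hr : 0 ≤ r) {β : ℝ} (hβ : 0 < β) (U μ : ℝ)
    (n : ℕ) (ψ₁ ψ₂ : FreqMomentum L M → ℝ) (Qm k k' : TorusSite 2 L) : 0 ≤ transferBarRelAtF L M G P r β U μ n ψ₁ ψ₂ Qm k k' :=
  transferBarRelAtWF_nonneg hCF hK hr β U n (klSoftMass_nonneg β μ _ hβ n _) (klShellOverlap_nonneg β μ _ hβ n _) Qm k k'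

/-- On the diagonal the bar of record vanishes. -/
theorem transferBarRelAtF_self (G : GeoConsts) (P : SplitConsts) (r β U μ : ℝ) (n : ℕ) (ψ : FreqMomentum L M → ℝ) (Qm k k' : TorusSite 2 L) :
    transferBarRelAtF L M G P r β U μ n ψ ψ Qm k k' = 0 := by
  unfold transferBarRelAtF transferBarRelAtWF transferBarRelAtW
  have h0 : ψ - ψ = fun _ => (0 : ℝ) := by funext x; simp
  rw [h0, klSoftMass_zero]
  have hov : klShellOverlap L M β μ (klFlowFrameU L M β U μ n) n (fun _ => (0 : ℝ)) = 0 := by simp [klShellOverlap]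
  rw [hov]
  ring

end BarF

end Summit.HubbardSuperconductivity.HubbardSuperconductivity.Theorems.KLRegimeSplit

end
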